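import Summits.QuantumFields.YangMills.Theorems.BalabanUVNodesN12FlatDatumRigidity
import HarnessLib

/-!
# BalabanUVNodes ∕ N12 — RIGIDITY AT THE FLAT DATUM FOR EVERY SEPARATED NESTED BLOCK-UNION SEQUENCE, PART 1 (PRELIMINARIES): levels of fine sites for the determining set (2.2)
# `genSet Ω k` of a nested block-union sequence with one-block collars, and the local chain words between the tower projections of adjacent fine sites

[Balaban1985Variational] = «[15]», Thm 1 p. 279, (1) p. 277, (3)–(4) p. 278; [Balaban1988Convergent] = «[III]», (2.1)–(2.2) pp. 254–255, (2.10)–(2.13) pp. 256–257; [Balaban1985RegularSpaces]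
(1.3)–(1.6) p. 77 (the collar `dist(Ω_n, Ω_{n−1}ᶜ) ≥ LⁿξM₁`); [Balaban1987RG1] (0.1)–(0.4) pp. 251–253; [Balaban1984PropagatorsI] (1.7) p. 18.

Cell `pub-ymgap` (HUMAN RULINGS D-0062 ∕ D-0149), lane `pub-ymgap-dag-n12-c` g30 (R134 seat (a), N12 = [B15], s1, LANE OWNER; key K1⁹ `stmt-QuantumFields-27364`,
`--kind proof --supports …`; count-neutral).  THEOREMS ONLY (0 `def`, 0 `instance`, 0 `sorry`).  dag-n12-w6 g17's `…N12TowerSiteGraphConnectedBjPrelim` ∕ `…N12FlatDatumRigidityPrelim` §4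
VERBATIM with the maximal-sequence facts (`isBlockUnion_maxDomT`, `dist_maxDomT`, `hcov_Bj`) replaced by three DISPLAYED hypotheses on an arbitrary sequence `Ω : ℕ → Set (Site P 0)`:
  (N) `Ω_{j+1} ⊆ Ω_j` (`1 ≤ j < k`);  (B) `Ω_j` is a union of `j`-blocks (`1 ≤ j ≤ k`; r12's `B14.Eq22Determines.IsBlockUnion`);
  (S) the ONE-BLOCK COLLAR: for `1 ≤ j`, `j + 1 ≤ k`, a fine site adjacent to a site of `Ω_{j+1}` has its whole `(j+1)`-block inside `Ω_j` ([6] (1.3)–(1.6)).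
PART 2 (`…N12FlatDatumRigidityNested`) carries the comb-gauge rigidity theorem; the sibling `…N12Thm1EUAtFlatDatumAllIndices` discharges (N)(B)(S) for r11's (2.18) indices and reads off the
non-vacuity of the lane's (E∕U) named facts `B11Thm1ExistsUniqueCoP7M(G)` at the flat datum over their whole index range (the lane's g30 audit; dag-n12-w1's LOCATED-3 settled in general).

CONTENTS.  §1 `isBlockUnion_of_succ`, `subset_of_le`, `level_zero_iff`, `mem_of_level`, `not_mem_succ_of_level`, ★ `exists_level_genSet`, ★ `level_unique_genSet`, ★ `levels_near_of_shift_genSet`,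
★ `mem_genSet_of_blockOf_eq_outerBlock`; §2 `exists_chainWord_same` (generic determining set), ★★ `exists_chainWord_up` ∕ `_down` ∕ `_of_shift`.

HONEST FRAMING.  Lattice combinatorics by name over landed kernel theorems; nothing of Bałaban's estimates; count-neutral helper; N12 NOT discharged; K1⁹ NOT closed; counts of record
unmoved; one finite 𝕋⁴ programme at fixed ε — R4 closes the conditional rung `BalabanLadder.UV` only; the Yang–Mills mass gap (Clay) is NOT proved by any of this; nothing continuum ∕ ℝ⁴ ∕ OS.
-/

namespace Summit.QuantumFields.YangMills.BalabanUVNodes.N12FlatDatumRigidityNestedPrelim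


open Set
open Literature.MathematicalPhysics.QuantumFieldTheory.Balaban1983to89
open B15DeterminingSets (DetSet pts mem_pts bondsOf embIter genSet gammaRegion_zero gammaRegion_mid gammaRegion_self pts_zero)
open B14.Eq22Determines (blockIter blockIter_zero blockIter_succ IsBlockUnion)
open B15Eq112TorusCover (cover lift cover_lift)
open T4Continuum (walk walkEnd holAt netDisp Letter LStep wordRev walk_append walkEnd_append holAt_append holAt_walk_wordRev wordRev_replicate
  netDisp_wordRev holAt_nil holAt_cons netDisp_cons walkEnd_apply walkEnd_walkEnd_wordRev holAt_gaugeAct_walk)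
open T4ReflectionCone (netDisp_append netDisp_replicate)
open B7Prop1Explicit (treeWord treeWord_zero)
open B16Sect1Backgrounds (toMS mulG gaugeAct_gaugeAct)
open Summit.QuantumFields.YangMills.Theorems.Prop7FlatHolonomy (holAt_walk_append holAt_walk_single_true)
open Summit.QuantumFields.YangMills.BalabanUVNodes.N12BlockChains (blockOf_shift_or exists_blockWalk_centre embIter_shift_eq_walkEnd)
open Summit.QuantumFields.YangMills.Theorems.N21ReadSetSupport (blockIter_embIter)
open Summit.QuantumFields.YangMills.BalabanUVNodes.N12TowerSiteGraphConnectedBjPrelim (blockIter_shift_or)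
open Summit.QuantumFields.YangMills.BalabanUVNodes.N12FlatDatumRigidityPrelim (natAbs_netDisp_le_length netDisp_eq_zero_of_walkEnd_eq walkEnd_treeWord_liftSub
  natAbs_netDisp_treeWord_liftSub_le holAt_walk_segments_eq_one walkEnd_segments natAbs_netDisp_segments_le segments_budget_le)
open Summit.QuantumFields.YangMills.BalabanUVNodes.N12FlatDatumRigidity (holAt_gaugeAct_one_walk holAt_comb_eq_one_of_eq)

variable {P : Params} {k : ℕ} {Ω : ℕ → Set (Site P 0)}

/-! ## §1  Levels for a nested block-union sequence: every fine site has exactly one scale `j ≤ k` whose member `Γ_j` contains its `j`-block -/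

/-- A union of `(j+1)`-blocks is a union of `j`-blocks (`j + 1 ≤ m + K`): the representative of the `j`-block of `x` lies in the `(j+1)`-block of `x`. [cite: Balaban1987RG1, (0.1) p.251 (bookkeeping)] -/
theorem isBlockUnion_of_succ {j : ℕ} (hj : j + 1 ≤ P.m + P.K) {X : Set (Site P 0)} (hX : IsBlockUnion (j + 1) X) : IsBlockUnion j X := by
  intro x
  have e : blockIter (j + 1) (embIter j (blockIter j x)) = blockIter (j + 1) x := by
    rw [blockIter_succ, blockIter_embIter (by omega), blockIter_succ]
  rw [hX x, hX (embIter j (blockIter j x)), e]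

/-- `Ω_n ⊆ Ω_m` for `1 ≤ m ≤ n ≤ k` under (N). [cite: Balaban1988Convergent, (2.1) p.254] -/
theorem subset_of_le (hnest : ∀ j, 1 ≤ j → j < k → Ω (j + 1) ⊆ Ω j) {m n : ℕ} (hm : 1 ≤ m) (hmn : m ≤ n) (hn : n ≤ k) : Ω n ⊆ Ω m := by
  induction n with
  | zero =>
    obtain rfl : m = 0 := by omega
    exact le_rfl
  | succ n ih =>
    rcases Nat.eq_or_lt_of_le hmn with rfl | hlt
    · exact le_rfl
    · exact (hnest n (by omega) (by omega)).trans (ih (by omega) (by omega))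

/-- **LEVEL `0`**: the `0`-block of `x` (= `x`) is a `Γ₀`-site iff `x ∉ Ω₁` (`Γ₀ = Ω₁ᶜ`, `k ≥ 1`). [cite: Balaban1988Convergent, (2.2) p.255] -/
theorem level_zero_iff (hk1 : 1 ≤ k) (x : Site P 0) : blockIter 0 x ∈ genSet Ω k 0 ↔ x ∉ Ω 1 := by
  rw [blockIter_zero]
  show x ∈ pts 0 _ ↔ _
  rw [gammaRegion_zero _ hk1, pts_zero]
  rfl

/-- **A POSITIVE LEVEL `j` PUTS `x` IN `Ω_j`** (`1 ≤ j ≤ k`, (B) at scale `j`). [cite: Balaban1988Convergent, (2.2) p.255] -/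
theorem mem_of_level (hBU : ∀ j, 1 ≤ j → j ≤ k → IsBlockUnion j (Ω j)) {j : ℕ} (hj1 : 1 ≤ j) (hjk : j ≤ k) {x : Site P 0}
    (h : blockIter j x ∈ genSet Ω k j) : x ∈ Ω j := by
  have hsub : genSet Ω k j ⊆ pts j (Ω j) := by
    rcases lt_or_eq_of_le hjk with hlt | rfl
    · intro y hy
      have hy' : y ∈ pts j (Ω j \ Ω (j + 1)) := by
        have e : genSet Ω k j = pts j (Ω j \ Ω (j + 1)) := congrArg (pts j) (gammaRegion_mid _ hj1 hlt)
        rw [← e]; exact hy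
      exact (mem_pts.1 hy').1
    · intro y hy
      have e : genSet Ω j j = pts j (Ω j) := congrArg (pts j) (gammaRegion_self _ j)
      rw [← e]; exact hy
  exact (hBU j hj1 hjk x).2 (mem_pts.1 (hsub h))

/-- **A LEVEL `j < k` KEEPS `x` OUT OF `Ω_{j+1}`** ((B) at scale `j + 1`, read at scale `j`). [cite: Balaban1988Convergent, (2.2) p.255] -/
theorem not_mem_succ_of_level (hk : k ≤ P.m + P.K) (hBU : ∀ j, 1 ≤ j → j ≤ k → IsBlockUnion j (Ω j)) {j : ℕ} (hjk : j < k) {x : Site P 0}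
    (h : blockIter j x ∈ genSet Ω k j) : x ∉ Ω (j + 1) := by
  rcases Nat.eq_zero_or_pos j with rfl | hj1
  · exact (level_zero_iff (by omega) x).1 h
  · have e : genSet Ω k j = pts j (Ω j \ Ω (j + 1)) := congrArg (pts j) (gammaRegion_mid _ hj1 hjk)
    rw [e] at h
    intro hx
    have hBU' : IsBlockUnion j (Ω (j + 1)) := isBlockUnion_of_succ (by omega) (hBU (j + 1) (by omega) (by omega))
    exact (mem_pts.1 h).2 ((hBU' x).1 hx)

/-- **EVERY FINE SITE HAS A LEVEL** under (N)(B): `x ∉ Ω₁` has level `0`; otherwise the last scale `n ≤ k` with `x ∈ Ω_n` is its level. [cite: Balaban1988Convergent, (2.2) p.255] -/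
theorem exists_level_genSet (hk1 : 1 ≤ k) (hk : k ≤ P.m + P.K) (hBU : ∀ j, 1 ≤ j → j ≤ k → IsBlockUnion j (Ω j)) (x : Site P 0) :
    ∃ j, j ≤ k ∧ blockIter j x ∈ genSet Ω k j := by
  classical
  by_cases h1 : x ∈ Ω 1
  · set n := Nat.findGreatest (fun i => x ∈ Ω i) k with hn
    have hnk : n ≤ k := Nat.findGreatest_le k
    have hn1 : 1 ≤ n := Nat.le_findGreatest (P := fun i => x ∈ Ω i) hk1 h1
    have hxn : x ∈ Ω n := Nat.findGreatest_spec (P := fun i => x ∈ Ω i) hk1 h1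
    have hrep : embIter n (blockIter n x) ∈ Ω n := (hBU n hn1 hnk x).1 hxn
    refine ⟨n, hnk, ?_⟩
    rcases lt_or_eq_of_le hnk with hlt | heq
    · have hnot : x ∉ Ω (n + 1) := Nat.findGreatest_is_greatest (P := fun i => x ∈ Ω i) (Nat.lt_succ_self n) (by omega)
      have hBU' : IsBlockUnion n (Ω (n + 1)) := isBlockUnion_of_succ (by omega) (hBU (n + 1) (by omega) (by omega))
      have hrep' : embIter n (blockIter n x) ∉ Ω (n + 1) := fun h => hnot ((hBU' x).2 h)
      have e : genSet Ω k n = pts n (Ω n \ Ω (n + 1)) := congrArg (pts n) (gammaRegion_mid _ hn1 hlt)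
      rw [e]
      exact mem_pts.2 ⟨hrep, hrep'⟩
    · have e : genSet Ω k n = pts n (Ω n) := by rw [← heq]; exact congrArg (pts n) (gammaRegion_self _ n)
      rw [e]
      exact mem_pts.2 hrep
  · exact ⟨0, by omega, (level_zero_iff hk1 x).2 h1⟩

/-- **THE LEVEL IS UNIQUE** under (N)(B). [cite: Balaban1988Convergent, (2.2) p.255] -/
theorem level_unique_genSet (hk : k ≤ P.m + P.K) (hnest : ∀ j, 1 ≤ j → j < k → Ω (j + 1) ⊆ Ω j)
    (hBU : ∀ j, 1 ≤ j → j ≤ k → IsBlockUnion j (Ω j)) {x : Site P 0}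
    {j j' : ℕ} (hj : j ≤ k) (hj' : j' ≤ k) (h : blockIter j x ∈ genSet Ω k j) (h' : blockIter j' x ∈ genSet Ω k j') : j = j' := by
  have key : ∀ {i i' : ℕ}, i ≤ k → i' ≤ k → blockIter i x ∈ genSet Ω k i → blockIter i' x ∈ genSet Ω k i' → ¬ i < i' := by
    intro i i' _ hi' hi hi'' hlt
    have h1 : x ∉ Ω (i + 1) := not_mem_succ_of_level hk hBU (lt_of_lt_of_le hlt hi') hi
    have h2 : x ∈ Ω i' := mem_of_level hBU (by omega) hi' hi''
    exact h1 (subset_of_le hnest (by omega) (Nat.succ_le_of_lt hlt) hi' h2)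
  rcases lt_trichotomy j j' with hlt | heq | hgt
  · exact absurd hlt (key hj hj' h h')
  · exact heq
  · exact absurd hgt (key hj' hj h' h)

/-- **ADJACENT FINE SITES HAVE LEVELS AT MOST ONE APART** under (N)(B)(S): a level gap of two would put `x` next to `Ω_{j+2}`, hence (collar at scale `j + 1`) inside `Ω_{j+1}`, which its
level `j` forbids. [cite: Balaban1985RegularSpaces, (1.3)–(1.6) p.77; Balaban1988Convergent, (2.13) pp.256–257] -/
theorem levels_near_of_shift_genSet (hk : k ≤ P.m + P.K) (hnest : ∀ j, 1 ≤ j → j < k → Ω (j + 1) ⊆ Ω j)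
    (hBU : ∀ j, 1 ≤ j → j ≤ k → IsBlockUnion j (Ω j))
    (hsep : ∀ j, 1 ≤ j → j + 1 ≤ k → ∀ (x z : Site P 0) (μ : Fin P.d), (z = x.shift μ ∨ x = z.shift μ) → z ∈ Ω (j + 1) →
      ∀ y : Site P 0, blockIter (j + 1) y = blockIter (j + 1) x → y ∈ Ω j)
    {x : Site P 0} {μ : Fin P.d} {j j' : ℕ} (hj : j ≤ k) (hj' : j' ≤ k)
    (h : blockIter j x ∈ genSet Ω k j) (h' : blockIter j' (x.shift μ) ∈ genSet Ω k j') : j' ≤ j + 1 ∧ j ≤ j' + 1 := by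
  constructor
  · by_contra hc
    push Not at hc
    have h2 : x.shift μ ∈ Ω (j + 1 + 1) := subset_of_le hnest (by omega) (by omega) hj' (mem_of_level hBU (by omega) hj' h')
    have hx : x ∈ Ω (j + 1) := hsep (j + 1) (by omega) (by omega) x (x.shift μ) μ (Or.inl rfl) h2 x rfl
    exact not_mem_succ_of_level hk hBU (by omega) h hx
  · by_contra hc
    push Not at hc
    have h2 : x ∈ Ω (j' + 1 + 1) := subset_of_le hnest (by omega) (by omega) hj (mem_of_level hBU (by omega) hj h)
    have hx : x.shift μ ∈ Ω (j' + 1) := hsep (j' + 1) (by omega) (by omega) (x.shift μ) x μ (Or.inr rfl) h2 (x.shift μ) rfl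
    exact not_mem_succ_of_level hk hBU (by omega) h' hx

/-- ★ **EVERY `ℓ`-SITE OF THE OUTER `(ℓ+1)`-BLOCK IS A `Γ_ℓ`-SITE** under (B)(S): `x ∉ Ω_{ℓ+1}` adjacent to `z ∈ Ω_{ℓ+1}` (`ℓ + 1 ≤ k`); every `ℓ`-site `v` of `B^{ℓ+1}(x)` has its
representative off `Ω_{ℓ+1}` ((B): a union of `(ℓ+1)`-blocks missing `x`) and, for `ℓ ≥ 1`, inside `Ω_ℓ` ((S)); for `ℓ = 0`, `Γ₀ = Ω₁ᶜ`. [cite: Balaban1988Convergent, (2.2) p.255, (2.13) pp.256–257] -/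
theorem mem_genSet_of_blockOf_eq_outerBlock (hk1 : 1 ≤ k) (hk : k ≤ P.m + P.K) (hBU : ∀ j, 1 ≤ j → j ≤ k → IsBlockUnion j (Ω j))
    (hsep : ∀ j, 1 ≤ j → j + 1 ≤ k → ∀ (x z : Site P 0) (μ : Fin P.d), (z = x.shift μ ∨ x = z.shift μ) → z ∈ Ω (j + 1) →
      ∀ y : Site P 0, blockIter (j + 1) y = blockIter (j + 1) x → y ∈ Ω j)
    {ℓ : ℕ} (hℓk : ℓ + 1 ≤ k) {x z : Site P 0} {μ : Fin P.d} (hadj : z = x.shift μ ∨ x = z.shift μ)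
    (hz : z ∈ Ω (ℓ + 1)) (hx : x ∉ Ω (ℓ + 1)) {v : Site P ℓ} (hv : blockOf v = blockIter (ℓ + 1) x) :
    v ∈ genSet Ω k ℓ := by
  have e1 : blockIter (ℓ + 1) (embIter ℓ v) = blockIter (ℓ + 1) x := by
    rw [blockIter_succ, blockIter_embIter (by omega) v, hv]
  have hBU1 := hBU (ℓ + 1) (by omega) hℓk
  have ha : embIter ℓ v ∉ Ω (ℓ + 1) := by
    intro hmem
    have h1 := (hBU1 (embIter ℓ v)).1 hmem
    rw [e1] at h1
    exact hx ((hBU1 x).2 h1)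
  rcases Nat.eq_zero_or_pos ℓ with hℓ0 | hℓ1
  · subst hℓ0
    have e : genSet Ω k 0 = pts 0 (Ω 1)ᶜ := congrArg (pts 0) (gammaRegion_zero _ hk1)
    rw [e]
    exact mem_pts.2 ha
  · have e : genSet Ω k ℓ = pts ℓ (Ω ℓ \ Ω (ℓ + 1)) := congrArg (pts ℓ) (gammaRegion_mid _ hℓ1 (by omega))
    rw [e]
    exact mem_pts.2 ⟨hsep ℓ hℓ1 hℓk x z μ hadj hz (embIter ℓ v) e1, ha⟩

/-! ## §2  The local chain words between the tower projections of adjacent fine sites (w6's §4, maximal-sequence facts replaced by (B)(S)) -/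

section Words

variable {G : Type*} [GaugeGroup G]

/-- ★★ **SAME LEVEL** (generic determining set): the empty word or the straight segment of the constrained bond `⟨B^j(x), μ⟩`. [cite: Balaban1988Convergent, (2.2) p.255, (2.10)–(2.12) p.256; Balaban1984PropagatorsI, (1.7) p.18] -/
theorem exists_chainWord_same (hk : k ≤ P.m + P.K) (𝔹 : DetSet P) {U : GaugeField P 0 G}
    (hseg : ∀ j, j ≤ k → ∀ c ∈ bondsOf (𝔹 j), holAt U (walk (embIter j c.src) (List.replicate (P.L ^ j) (c.dir, true))) = 1)
    {x : Site P 0} {μ : Fin P.d} {j : ℕ} (hj : j ≤ k) (h : blockIter j x ∈ 𝔹 j) :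
    ∃ ω : List (Letter P.d), walkEnd (embIter j (blockIter j x)) ω = embIter j (blockIter j (x.shift μ)) ∧
      holAt U (walk (embIter j (blockIter j x)) ω) = 1 ∧ ∀ ν, (netDisp ω ν).natAbs ≤ (P.d + 1) * P.L ^ k := by
  rcases blockIter_shift_or (hj.trans hk) x μ with e | e
  · exact ⟨[], by rw [e]; rfl, by simp [walk, holAt_nil], fun ν => by simp [netDisp]⟩
  · have hb : P.L ^ j ≤ (P.d + 1) * P.L ^ k :=
      le_trans (Nat.pow_le_pow_right P.L_pos hj) (Nat.le_mul_of_pos_left _ (Nat.succ_pos _))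
    refine ⟨List.replicate (P.L ^ j) (μ, true), ?_, hseg j hj ⟨blockIter j x, μ⟩ (Or.inl h), fun ν => ?_⟩
    · rw [e]; exact (embIter_shift_eq_walkEnd j _ μ).symm
    · rw [netDisp_replicate]
      split_ifs <;> simp [hb]

/-- ★★ **ONE LEVEL UP** under (B)(S): the in-block walk from `B^j(x)` to the centre of `B^{j+1}(x)` (constrained level-`j` links by `mem_genSet_of_blockOf_eq_outerBlock`) followed by the
straight segment of the constrained `(j+1)`-bond `⟨B^{j+1}(x), μ⟩`. [cite: Balaban1988Convergent, (2.2) p.255, (2.13) pp.256–257; Balaban1984PropagatorsI, (1.7) p.18] -/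
theorem exists_chainWord_up (hk1 : 1 ≤ k) (hk : k ≤ P.m + P.K) (hBU : ∀ j, 1 ≤ j → j ≤ k → IsBlockUnion j (Ω j))
    (hsep : ∀ j, 1 ≤ j → j + 1 ≤ k → ∀ (x z : Site P 0) (μ : Fin P.d), (z = x.shift μ ∨ x = z.shift μ) → z ∈ Ω (j + 1) →
      ∀ y : Site P 0, blockIter (j + 1) y = blockIter (j + 1) x → y ∈ Ω j)
    {U : GaugeField P 0 G}
    (hseg : ∀ j, j ≤ k → ∀ c ∈ bondsOf (genSet Ω k j), holAt U (walk (embIter j c.src) (List.replicate (P.L ^ j) (c.dir, true))) = 1)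
    {x : Site P 0} {μ : Fin P.d} {j : ℕ} (hj : j + 1 ≤ k)
    (h : blockIter j x ∈ genSet Ω k j) (h' : blockIter (j + 1) (x.shift μ) ∈ genSet Ω k (j + 1)) :
    ∃ ω : List (Letter P.d), walkEnd (embIter j (blockIter j x)) ω = embIter (j + 1) (blockIter (j + 1) (x.shift μ)) ∧
      holAt U (walk (embIter j (blockIter j x)) ω) = 1 ∧ ∀ ν, (netDisp ω ν).natAbs ≤ (P.d + 1) * P.L ^ k := by
  have hx : x ∉ Ω (j + 1) := not_mem_succ_of_level hk hBU (by omega) h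
  have hx' : x.shift μ ∈ Ω (j + 1) := mem_of_level hBU (by omega) hj h'
  have hBU1 := hBU (j + 1) (by omega) hj
  rcases blockIter_shift_or (show j + 1 ≤ P.m + P.K by omega) x μ with e | e
  · exfalso
    have h1 := (hBU1 (x.shift μ)).1 hx'
    rw [e] at h1
    exact hx ((hBU1 x).2 h1)
  · obtain ⟨ch, hlen, hmem, hend, hcons⟩ := exists_blockWalk_centre (show j + 1 ≤ P.m + P.K by omega) (blockIter j x) (emb (blockIter (j + 1) x))
      (blockIter (j + 1) x) (blockIter_succ j x).symm (Site.blockOf_emb (by omega) _) (Or.inr rfl)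
    have hchseg : ∀ l ∈ ch, holAt U (walk (embIter j l.1.src) (List.replicate (P.L ^ j) (l.1.dir, true))) = 1 := fun l hl =>
      hseg j (by omega) l.1 (Or.inl (mem_genSet_of_blockOf_eq_outerBlock hk1 hk hBU hsep hj (Or.inl rfl) hx' hx (hmem l hl).1))
    have e1 : walkEnd (embIter j (blockIter j x)) ((ch.map fun l => List.replicate (P.L ^ j) (l.1.dir, l.2)).flatten) = embIter (j + 1) (blockIter (j + 1) x) := by
      rw [walkEnd_segments, hend]; rfl
    have hc : (⟨blockIter (j + 1) x, μ⟩ : PBond P (j + 1)) ∈ bondsOf (genSet Ω k (j + 1)) := by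
      refine Or.inr ?_
      show (blockIter (j + 1) x).shift μ ∈ genSet Ω k (j + 1)
      rw [← e]; exact h'
    refine ⟨(ch.map fun l => List.replicate (P.L ^ j) (l.1.dir, l.2)).flatten ++ List.replicate (P.L ^ (j + 1)) (μ, true), ?_, ?_, fun ν => ?_⟩
    · rw [walkEnd_append, e1, e]
      exact (embIter_shift_eq_walkEnd (j + 1) _ μ).symm
    · have hs := hseg (j + 1) hj _ hc
      rw [holAt_walk_append, holAt_walk_segments_eq_one U ch _ hchseg hcons, one_mul, e1]
      exact hs
    · rw [netDisp_append]
      have h1 := natAbs_netDisp_segments_le ch ν (i := j)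
      have h2 : (netDisp (List.replicate (P.L ^ (j + 1)) ((μ, true) : Letter P.d)) ν).natAbs ≤ P.L ^ (j + 1) := by
        rw [netDisp_replicate]; split_ifs <;> simp
      calc _ ≤ _ + _ := Int.natAbs_add_le _ _
        _ ≤ P.L ^ j * ch.length + P.L ^ (j + 1) := add_le_add h1 h2
        _ ≤ (P.d + 1) * P.L ^ k := segments_budget_le hj hlen

/-- ★★ **ONE LEVEL DOWN** under (B)(S). [cite: Balaban1988Convergent, (2.2) p.255, (2.13) pp.256–257; Balaban1984PropagatorsI, (1.7) p.18] -/
theorem exists_chainWord_down (hk1 : 1 ≤ k) (hk : k ≤ P.m + P.K) (hBU : ∀ j, 1 ≤ j → j ≤ k → IsBlockUnion j (Ω j))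
    (hsep : ∀ j, 1 ≤ j → j + 1 ≤ k → ∀ (x z : Site P 0) (μ : Fin P.d), (z = x.shift μ ∨ x = z.shift μ) → z ∈ Ω (j + 1) →
      ∀ y : Site P 0, blockIter (j + 1) y = blockIter (j + 1) x → y ∈ Ω j)
    {U : GaugeField P 0 G}
    (hseg : ∀ j, j ≤ k → ∀ c ∈ bondsOf (genSet Ω k j), holAt U (walk (embIter j c.src) (List.replicate (P.L ^ j) (c.dir, true))) = 1)
    {x : Site P 0} {μ : Fin P.d} {j : ℕ} (hj : j + 1 ≤ k)
    (h : blockIter (j + 1) x ∈ genSet Ω k (j + 1)) (h' : blockIter j (x.shift μ) ∈ genSet Ω k j) :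
    ∃ ω : List (Letter P.d), walkEnd (embIter (j + 1) (blockIter (j + 1) x)) ω = embIter j (blockIter j (x.shift μ)) ∧
      holAt U (walk (embIter (j + 1) (blockIter (j + 1) x)) ω) = 1 ∧ ∀ ν, (netDisp ω ν).natAbs ≤ (P.d + 1) * P.L ^ k := by
  have hx : x ∈ Ω (j + 1) := mem_of_level hBU (by omega) hj h
  have hx' : x.shift μ ∉ Ω (j + 1) := not_mem_succ_of_level hk hBU (by omega) h'
  have hBU1 := hBU (j + 1) (by omega) hj
  rcases blockIter_shift_or (show j + 1 ≤ P.m + P.K by omega) x μ with e | e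
  · exfalso
    have h1 := (hBU1 x).1 hx
    rw [← e] at h1
    exact hx' ((hBU1 (x.shift μ)).2 h1)
  · obtain ⟨ch, hlen, hmem, hend, hcons⟩ := exists_blockWalk_centre (show j + 1 ≤ P.m + P.K by omega) (emb (blockIter (j + 1) (x.shift μ)))
      (blockIter j (x.shift μ)) (blockIter (j + 1) (x.shift μ)) (Site.blockOf_emb (by omega) _) (blockIter_succ j (x.shift μ)).symm (Or.inl rfl)
    have hchseg : ∀ l ∈ ch, holAt U (walk (embIter j l.1.src) (List.replicate (P.L ^ j) (l.1.dir, true))) = 1 := fun l hl =>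
      hseg j (by omega) l.1 (Or.inl (mem_genSet_of_blockOf_eq_outerBlock hk1 hk hBU hsep hj (Or.inr rfl) hx hx' (hmem l hl).1))
    have hc : (⟨blockIter (j + 1) x, μ⟩ : PBond P (j + 1)) ∈ bondsOf (genSet Ω k (j + 1)) := Or.inl h
    have e1 : walkEnd (embIter (j + 1) (blockIter (j + 1) x)) (List.replicate (P.L ^ (j + 1)) (μ, true)) = embIter j (emb (blockIter (j + 1) (x.shift μ))) := by
      rw [← embIter_shift_eq_walkEnd, ← e]; rfl
    refine ⟨List.replicate (P.L ^ (j + 1)) (μ, true) ++ (ch.map fun l => List.replicate (P.L ^ j) (l.1.dir, l.2)).flatten, ?_, ?_, fun ν => ?_⟩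
    · rw [walkEnd_append, e1, walkEnd_segments, hend]
    · rw [holAt_walk_append, hseg (j + 1) hj _ hc, one_mul, e1]
      exact holAt_walk_segments_eq_one U ch _ hchseg hcons
    · rw [netDisp_append]
      have h1 := natAbs_netDisp_segments_le ch ν (i := j)
      have h2 : (netDisp (List.replicate (P.L ^ (j + 1)) ((μ, true) : Letter P.d)) ν).natAbs ≤ P.L ^ (j + 1) := by
        rw [netDisp_replicate]; split_ifs <;> simp
      calc _ ≤ _ + _ := Int.natAbs_add_le _ _
        _ ≤ P.L ^ (j + 1) + P.L ^ j * ch.length := add_le_add h2 h1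
        _ = P.L ^ j * ch.length + P.L ^ (j + 1) := add_comm _ _
        _ ≤ (P.d + 1) * P.L ^ k := segments_budget_le hj hlen

/-- ★★ **THE LOCAL CHAIN WORD OF A FINE BOND** under (N)(B)(S). [cite: Balaban1988Convergent, (2.2) p.255, (2.13) pp.256–257; Balaban1984PropagatorsI, (1.7) p.18] -/
theorem exists_chainWord_of_shift (hk1 : 1 ≤ k) (hk : k ≤ P.m + P.K) (hnest : ∀ j, 1 ≤ j → j < k → Ω (j + 1) ⊆ Ω j)
    (hBU : ∀ j, 1 ≤ j → j ≤ k → IsBlockUnion j (Ω j))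
    (hsep : ∀ j, 1 ≤ j → j + 1 ≤ k → ∀ (x z : Site P 0) (μ : Fin P.d), (z = x.shift μ ∨ x = z.shift μ) → z ∈ Ω (j + 1) →
      ∀ y : Site P 0, blockIter (j + 1) y = blockIter (j + 1) x → y ∈ Ω j)
    {U : GaugeField P 0 G}
    (hseg : ∀ j, j ≤ k → ∀ c ∈ bondsOf (genSet Ω k j), holAt U (walk (embIter j c.src) (List.replicate (P.L ^ j) (c.dir, true))) = 1)
    (x : Site P 0) (μ : Fin P.d) {j j' : ℕ} (hj : j ≤ k) (hj' : j' ≤ k)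
    (h : blockIter j x ∈ genSet Ω k j) (h' : blockIter j' (x.shift μ) ∈ genSet Ω k j') :
    ∃ ω : List (Letter P.d), walkEnd (embIter j (blockIter j x)) ω = embIter j' (blockIter j' (x.shift μ)) ∧
      holAt U (walk (embIter j (blockIter j x)) ω) = 1 ∧ ∀ ν, (netDisp ω ν).natAbs ≤ (P.d + 1) * P.L ^ k := by
  obtain ⟨h1, h2⟩ := levels_near_of_shift_genSet hk hnest hBU hsep hj hj' h h'
  rcases lt_trichotomy j j' with hlt | rfl | hgt
  · obtain rfl : j' = j + 1 := by omega
    exact exists_chainWord_up hk1 hk hBU hsep hseg hj' h h'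
  · exact exists_chainWord_same hk (genSet Ω k) hseg hj h
  · obtain rfl : j = j' + 1 := by omega
    exact exists_chainWord_down hk1 hk hBU hsep hseg hj h h'

end Words

end Summit.QuantumFields.YangMills.BalabanUVNodes.N12FlatDatumRigidityNestedPrelim
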